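import Mathlib.Analysis.Complex.Basic
import Mathlib.Tactic
import Literature.Combinatorics.StablePolynomials.NegativeCorrelation
import Literature.Combinatorics.StablePolynomials.InsertionFamilies
import Summits.CriticalPhenomena.PercolationContinuityZ3.Theorems.PercNearOneGluingNoHeavyLowerTailFederMihailPrelims
import HarnessLib

/-!
# The Feder–Mihail inequality for homogeneous strongly Rayleigh coefficient families

Support file for the Sahi / Conjecture-P programme of route `PercNearOneGluingNoHeavy`
(`--supports stmt-CriticalPhenomena-4575`, prover prim-l12-p5 gen 31; proof note
`prim-l12-p5/MULTITYPE-PROOF-g31.md` §2).  No definitions, no named facts, no sorries.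

Setting: a real coefficient family `a : Finset σ → ℝ` that is non-negative, HOMOGENEOUS (every set
of non-zero weight has the same cardinality `k`), supported on the subsets of a ground finset `𝔽`,
and "stable or zero" in the coefficient form used throughout
`Literature.Combinatorics.StablePolynomials.*` (the generating polynomial `Σ_S a(S) z^S` is
identically zero or zero-free on the open upper half-space) — an unnormalised strongly Rayleigh
measure carried by one level.  THEOREM (Feder–Mihail 1992 for balanced matroids; the form used
here is the one isolated by Borcea–Brändén–Liggett, *Negative dependence and the geometry of
polynomials*, J. Amer. Math. Soc. 22 (2009), Thm 4.8 and proof of Prop. 4.12): for every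
coordinate `e` and every functional `F` that is SWAP-MONOTONE away from `e` (`F(S) ≤ F(S ∖ e ∪ g)`
for `S ∋ e` in the support and `g ∈ 𝔽 ∖ S`; e.g. any increasing `F` not depending on `e`),

  `(Σ_{S ∋ e} a(S) F(S)) · (Σ_S a(S)) ≤ (Σ_S a(S) F(S)) · (Σ_{S ∋ e} a(S))`,

i.e. `E[F | e ∈ S] ≤ E[F]`.  Proof = the Feder–Mihail induction on `|𝔽|`: condition on a second
coordinate `f` of non-negative influence on `F` under `a(· | e ∉ S)` with `a(e, f ∉ S) > 0` (if no
such `f` exists, `a(· | e ∉ S)` is a point mass: `fm_point_mass`); use the induction hypothesis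
for the minors `a(· | f ∈ S)`, `a(· | f ∉ S)` — again homogeneous and stable-or-zero by
`multiAffine_stableOrZero_derivFamily` / `multiAffine_stableOrZero_specialize` of the tree — the
pairwise negative correlation of `e, f` (`multiAffine_pairwise_negCorr` of the tree) and the
four-cell inequality `FederMihail.four_cell`.

This replaces [BBL 2009, Thm 4.19] (stochastically increasing levels) in the tree's proof of
THEOREM MT (LSM-Z-2D for every multi-type de Finetti law with integer rates): the neutral-site
variable of the site model is the homogenising variable, see `…LowerTailSiteCovariance`.

* `feder_mihail` : the theorem (ground finset of prescribed cardinality, for the induction);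
* `feder_mihail_univ` : the same on the whole type.
-/

namespace Summit.CriticalPhenomena.PercolationContinuityZ3.Theorems

namespace FederMihail

open Finset Literature.Combinatorics.StablePolynomials

variable {σ : Type*} [Fintype σ] [DecidableEq σ]

/-- **The Feder–Mihail inequality** (Feder–Mihail 1992; Borcea–Brändén–Liggett 2009, Thm 4.8 and
proof of Prop 4.12), unnormalised coefficient form.  Let `a ≥ 0` be a real family on the subsets
of a ground finset `𝔽` (`a(S) ≠ 0 ⇒ S ⊆ 𝔽`), homogeneous (`a(S) ≠ 0 ⇒ |S| = k`) and stable-or-zero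
(`Σ_S a(S) z^S` identically zero or zero-free on the open upper half-space).  Let `e` be a
coordinate and `F` a functional with the swap property `F(S) ≤ F(S ∖ e ∪ g)` for every `S ∋ e` of
non-zero weight and every `g ∈ 𝔽 ∖ S`.  Then
`(Σ_{S ∋ e} a F)·(Σ a) ≤ (Σ a F)·(Σ_{S ∋ e} a)`, i.e. `E[F | e ∈ S] ≤ E[F]`.
(Induction on `|𝔽|`; see the module docstring.) -/
theorem feder_mihail (e : σ) (n : ℕ) : ∀ (𝔽 : Finset σ), 𝔽.card = n →
    ∀ (a : Finset σ → ℝ) (k : ℕ) (F : Finset σ → ℝ),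
      (∀ S, 0 ≤ a S) → (∀ S, a S ≠ 0 → S ⊆ 𝔽) →
      ((∀ S, a S = 0) ∨
        ∀ z : σ → ℂ, (∀ i, 0 < (z i).im) → (∑ S : Finset σ, (a S : ℂ) * ∏ i ∈ S, z i) ≠ 0) →
      (∀ S, a S ≠ 0 → S.card = k) →
      (∀ S, a S ≠ 0 → e ∈ S → ∀ g ∈ 𝔽, g ∉ S → F S ≤ F (insert g (S.erase e))) →
      (∑ S ∈ univ.filter (fun S : Finset σ => e ∈ S), a S * F S) * (∑ S, a S) ≤
        (∑ S, a S * F S) * (∑ S ∈ univ.filter (fun S : Finset σ => e ∈ S), a S) := by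
  induction n with
  | zero =>
    intro 𝔽 h𝔽 a k F _ hsupp _ _ _
    have hF : 𝔽 = ∅ := Finset.card_eq_zero.1 h𝔽
    refine fm_case_in_zero e a F fun S heS => ?_
    by_contra h
    have := hsupp S h heS
    rw [hF] at this
    exact absurd this (Finset.notMem_empty e)
  | succ n ih =>
    intro 𝔽 h𝔽 a k F ha0 hsupp hst hhom hswap
    by_cases hA : ∀ S, e ∈ S → a S = 0
    · exact fm_case_in_zero e a F hA
    by_cases hB : ∀ S, e ∉ S → a S = 0
    · exact fm_case_out_zero e a F hB
    push Not at hA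
    obtain ⟨S₁, heS₁, haS₁⟩ := hA
    have he𝔽 : e ∈ 𝔽 := hsupp S₁ haS₁ heS₁
    -- the family conditioned on `e ∉ S`
    set b : Finset σ → ℝ := fun S => if e ∈ S then 0 else a S with hbdef
    have hb0 : ∀ S, 0 ≤ b S := fun S => by
      simp only [hbdef]; split_ifs; exacts [le_rfl, ha0 S]
    have hbsupp : ∀ S, b S ≠ 0 → S ⊆ 𝔽.erase e := by
      intro S hS
      simp only [hbdef] at hS
      split_ifs at hS with h
      · exact absurd rfl hS
      · intro x hx
        exact Finset.mem_erase.2 ⟨fun hxe => h (hxe ▸ hx), hsupp S hS hx⟩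
    have hbhom : ∀ S, b S ≠ 0 → S.card = k := by
      intro S hS
      simp only [hbdef] at hS
      split_ifs at hS with h
      · exact absurd rfl hS
      · exact hhom S hS
    have hsum0 := influence_sum_zero (𝔽.erase e) b k hbsupp hbhom F
    -- total sums
    have total : ∀ φ : Finset σ → ℝ, ∑ S, φ S =
        ∑ S ∈ univ.filter (fun S : Finset σ => e ∈ S), φ S +
        ∑ S ∈ univ.filter (fun S : Finset σ => e ∉ S), φ S := fun φ => sum_split e φ
    -- the dichotomy: a coordinate of non-negative influence with `v₀ > 0`, or a point mass
    by_cases hPI : ∃ f ∈ 𝔽.erase e,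
        0 ≤ (∑ S ∈ univ.filter (fun S : Finset σ => f ∈ S), b S * F S) * (∑ S, b S) -
              (∑ S, b S * F S) * (∑ S ∈ univ.filter (fun S : Finset σ => f ∈ S), b S) ∧
          0 < ∑ S, (if f ∈ S then 0 else b S)
    · obtain ⟨f, hf, hTf, hVf⟩ := hPI
      have hfe : f ≠ e := (Finset.mem_erase.1 hf).1
      have hf𝔽 : f ∈ 𝔽 := (Finset.mem_erase.1 hf).2
      have hcard : (𝔽.erase f).card = n := by
        rw [Finset.card_erase_of_mem hf𝔽, h𝔽]; rfl
      obtain ⟨c1, c2, c3, c4⟩ := cell_split e f hfe a F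
      -- the eight cells
      set u₁ := ∑ S ∈ univ.filter (fun S : Finset σ => e ∈ S), (if f ∈ S then 0 else a (insert f S))
        with hu₁
      set u₀ := ∑ S ∈ univ.filter (fun S : Finset σ => e ∈ S), (if f ∈ S then 0 else a S) with hu₀
      set v₁ := ∑ S ∈ univ.filter (fun S : Finset σ => e ∉ S), (if f ∈ S then 0 else a (insert f S))
        with hv₁
      set v₀ := ∑ S ∈ univ.filter (fun S : Finset σ => e ∉ S), (if f ∈ S then 0 else a S) with hv₀
      set x₁ := ∑ S ∈ univ.filter (fun S : Finset σ => e ∈ S),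
        (if f ∈ S then 0 else a (insert f S)) * F (insert f S) with hx₁
      set x₀ := ∑ S ∈ univ.filter (fun S : Finset σ => e ∈ S), (if f ∈ S then 0 else a S) * F S
        with hx₀
      set y₁ := ∑ S ∈ univ.filter (fun S : Finset σ => e ∉ S),
        (if f ∈ S then 0 else a (insert f S)) * F (insert f S) with hy₁
      set y₀ := ∑ S ∈ univ.filter (fun S : Finset σ => e ∉ S), (if f ∈ S then 0 else a S) * F S
        with hy₀
      clear_value u₁ u₀ v₁ v₀ x₁ x₀ y₁ y₀
      -- induction hypothesis for the minor `f ∈ S`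
      have IH₁ := ih (𝔽.erase f) hcard (fun S => if f ∈ S then 0 else a (insert f S)) (k - 1)
        (fun S => F (insert f S))
        (fun S => by split_ifs; exacts [le_rfl, ha0 _])
        (by
          intro S hS
          have hfS : f ∉ S := by intro h; rw [if_pos h] at hS; exact hS rfl
          rw [if_neg hfS] at hS
          have hsub := hsupp _ hS
          intro x hx
          exact Finset.mem_erase.2 ⟨fun hxf => hfS (hxf ▸ hx), hsub (Finset.mem_insert_of_mem hx)⟩)
        (multiAffine_stableOrZero_derivFamily a hst f)
        (by
          intro S hS
          have hfS : f ∉ S := by intro h; rw [if_pos h] at hS; exact hS rfl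
          rw [if_neg hfS] at hS
          have := hhom _ hS
          rw [Finset.card_insert_of_notMem hfS] at this
          omega)
        (by
          intro S hS heS g hg hgS
          have hfS : f ∉ S := by intro h; rw [if_pos h] at hS; exact hS rfl
          rw [if_neg hfS] at hS
          have hg𝔽 : g ∈ 𝔽 := (Finset.mem_erase.1 hg).2
          have hgf : g ≠ f := (Finset.mem_erase.1 hg).1
          have hgS' : g ∉ insert f S := by
            rw [Finset.mem_insert]; push Not; exact ⟨hgf, hgS⟩
          have h := hswap (insert f S) hS (Finset.mem_insert_of_mem heS) g hg𝔽 hgS'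
          rwa [Finset.erase_insert_of_ne hfe, Finset.insert_comm] at h)
      -- induction hypothesis for the minor `f ∉ S`
      have hst₀ := multiAffine_stableOrZero_specialize a hst f 0
      simp only [zero_mul, add_zero] at hst₀
      have IH₀ := ih (𝔽.erase f) hcard (fun S => if f ∈ S then 0 else a S) k F
        (fun S => by split_ifs; exacts [le_rfl, ha0 _])
        (by
          intro S hS
          have hfS : f ∉ S := by intro h; rw [if_pos h] at hS; exact hS rfl
          rw [if_neg hfS] at hS
          intro x hx
          exact Finset.mem_erase.2 ⟨fun hxf => hfS (hxf ▸ hx), hsupp S hS hx⟩)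
        hst₀
        (by
          intro S hS
          have hfS : f ∉ S := by intro h; rw [if_pos h] at hS; exact hS rfl
          rw [if_neg hfS] at hS
          exact hhom S hS)
        (by
          intro S hS heS g hg hgS
          have hfS : f ∉ S := by intro h; rw [if_pos h] at hS; exact hS rfl
          rw [if_neg hfS] at hS
          exact hswap S hS heS g (Finset.mem_erase.1 hg).2 hgS)
      rw [total, total] at IH₁ IH₀
      rw [← hu₁, ← hv₁, ← hx₁, ← hy₁] at IH₁
      rw [← hu₀, ← hv₀, ← hx₀, ← hy₀] at IH₀
      -- pairwise negative correlation of `e, f`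
      have PNC := multiAffine_pairwise_negCorr a hst hfe.symm
      have hPin : ∀ S : Finset σ, e ∈ insert f S ↔ e ∈ S := fun S => by
        rw [Finset.mem_insert]; exact ⟨fun h => h.resolve_left hfe.symm, Or.inr⟩
      have hef_cell : ∑ S ∈ univ.filter (fun S : Finset σ => e ∈ S ∧ f ∈ S), a S = u₁ := by
        rw [hu₁, sum_cond_in_filter f _ hPin a]
      have hf_cell : ∑ S ∈ univ.filter (fun S : Finset σ => f ∈ S), a S = u₁ + v₁ := by
        rw [← sum_cond_in f a, total, hu₁, hv₁]
      have hall : ∑ S, a S = u₁ + u₀ + (v₁ + v₀) := by rw [total, c1, c2]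
      rw [hef_cell, hf_cell, hall, c1] at PNC
      -- non-negative influence of `f` under `b`
      have hPout : ∀ S : Finset σ, e ∉ insert f S ↔ e ∉ S := fun S => (hPin S).not
      have hbF : ∀ S, b S * F S = if e ∈ S then 0 else a S * F S := fun S => by
        simp only [hbdef]; split_ifs <;> simp
      have hb1 : ∑ S ∈ univ.filter (fun S : Finset σ => f ∈ S), b S * F S = y₁ := by
        simp only [hbF]
        rw [sum_cond_out_filter e _ (fun S => a S * F S), hy₁]
        have hre : ∑ S ∈ univ.filter (fun S : Finset σ => e ∉ S),
            (if f ∈ S then 0 else a (insert f S)) * F (insert f S) =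
            ∑ S ∈ univ.filter (fun S : Finset σ => e ∉ S),
            (if f ∈ S then 0 else a (insert f S) * F (insert f S)) :=
          Finset.sum_congr rfl fun S _ => by split_ifs <;> simp
        rw [hre, sum_cond_in_filter f _ hPout (fun S => a S * F S)]
        exact Finset.sum_congr (Finset.filter_congr fun S _ => and_comm) fun _ _ => rfl
      have hb2 : ∑ S, b S = v₁ + v₀ := by
        simp only [hbdef]
        rw [sum_cond_out e a, c2]
      have hb3 : ∑ S, b S * F S = y₁ + y₀ := by
        simp only [hbF]
        rw [sum_cond_out e (fun S => a S * F S), c4]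
      have hb4 : ∑ S ∈ univ.filter (fun S : Finset σ => f ∈ S), b S = v₁ := by
        simp only [hbdef]
        rw [sum_cond_out_filter e _ a, hv₁, sum_cond_in_filter f _ hPout a]
        exact Finset.sum_congr (Finset.filter_congr fun S _ => and_comm) fun _ _ => rfl
      have hb5 : ∑ S, (if f ∈ S then 0 else b S) = v₀ := by
        simp only [hbdef]
        rw [sum_cond_out f, hv₀, sum_cond_out_filter f _ a, sum_cond_out_filter e _ a]
        exact Finset.sum_congr (Finset.filter_congr fun S _ => and_comm) fun _ _ => rfl
      rw [hb1, hb2, hb3, hb4] at hTf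
      rw [hb5] at hVf
      -- signs
      have hu₁0 : 0 ≤ u₁ := by
        rw [hu₁]; exact Finset.sum_nonneg fun S _ => by split_ifs; exacts [le_rfl, ha0 _]
      have hv₁0 : 0 ≤ v₁ := by
        rw [hv₁]; exact Finset.sum_nonneg fun S _ => by split_ifs; exacts [le_rfl, ha0 _]
      have hx₁0 : u₁ = 0 → x₁ = 0 := by
        intro h
        rw [hu₁] at h
        have hz := (Finset.sum_eq_zero_iff_of_nonneg fun S _ => by
          split_ifs; exacts [le_rfl, ha0 _]).1 h
        rw [hx₁]
        refine Finset.sum_eq_zero fun S hS => ?_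
        rw [hz S hS, zero_mul]
      have hy₁0 : v₁ = 0 → y₁ = 0 := by
        intro h
        rw [hv₁] at h
        have hz := (Finset.sum_eq_zero_iff_of_nonneg fun S _ => by
          split_ifs; exacts [le_rfl, ha0 _]).1 h
        rw [hy₁]
        refine Finset.sum_eq_zero fun S hS => ?_
        rw [hz S hS, zero_mul]
      have key := four_cell x₁ x₀ y₁ y₀ u₁ u₀ v₁ v₀ hu₁0 hv₁0 hVf hx₁0 hy₁0
        (by linarith [IH₁]) (by linarith [IH₀]) (by linarith [PNC]) (by linarith [hTf])
      rw [total (fun S => a S * F S), c3, c4, hall, c1]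
      linarith [key]
    · -- point mass: `b` is supported on `𝔽.erase e`
      push Not at hPI
      have hVnn : ∀ f, 0 ≤ ∑ S, (if f ∈ S then (0:ℝ) else b S) := fun f =>
        Finset.sum_nonneg fun S _ => by split_ifs; exacts [le_rfl, hb0 S]
      have hV0 : ∀ f ∈ 𝔽.erase e,
          0 ≤ (∑ S ∈ univ.filter (fun S : Finset σ => f ∈ S), b S * F S) * (∑ S, b S) -
              (∑ S, b S * F S) * (∑ S ∈ univ.filter (fun S : Finset σ => f ∈ S), b S) →
          ∀ S, f ∉ S → b S = 0 := by
        intro f hf hT S hfS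
        have hle := hPI f hf hT
        have h0 : ∑ S, (if f ∈ S then (0:ℝ) else b S) = 0 := le_antisymm hle (hVnn f)
        have := (Finset.sum_eq_zero_iff_of_nonneg (fun S _ => by
          split_ifs; exacts [le_rfl, hb0 S])).1 h0 S (Finset.mem_univ S)
        rwa [if_neg hfS] at this
      have hterm0 : ∀ f ∈ 𝔽.erase e, (∀ S, f ∉ S → b S = 0) →
          (∑ S ∈ univ.filter (fun S : Finset σ => f ∈ S), b S * F S) * (∑ S, b S) -
              (∑ S, b S * F S) * (∑ S ∈ univ.filter (fun S : Finset σ => f ∈ S), b S) = 0 := by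
        intro f _ hz
        have h1 : ∑ S ∈ univ.filter (fun S : Finset σ => f ∈ S), b S * F S = ∑ S, b S * F S := by
          rw [Finset.sum_filter]
          refine Finset.sum_congr rfl fun S _ => ?_
          by_cases h : f ∈ S
          · rw [if_pos h]
          · rw [if_neg h, hz S h, zero_mul]
        have h2 : ∑ S ∈ univ.filter (fun S : Finset σ => f ∈ S), b S = ∑ S, b S := by
          rw [Finset.sum_filter]
          refine Finset.sum_congr rfl fun S _ => ?_
          by_cases h : f ∈ S
          · rw [if_pos h]
          · rw [if_neg h, hz S h]
        rw [h1, h2]; ring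
      have hnonpos : ∀ f ∈ 𝔽.erase e,
          (∑ S ∈ univ.filter (fun S : Finset σ => f ∈ S), b S * F S) * (∑ S, b S) -
              (∑ S, b S * F S) * (∑ S ∈ univ.filter (fun S : Finset σ => f ∈ S), b S) ≤ 0 := by
        intro f hf
        by_contra hpos
        push Not at hpos
        have := hterm0 f hf (hV0 f hf hpos.le)
        linarith
      have hall0 := (Finset.sum_eq_zero_iff_of_nonpos hnonpos).1 hsum0
      have hpt : ∀ S, b S ≠ 0 → S = 𝔽.erase e := by
        intro S hS
        refine Finset.Subset.antisymm (hbsupp S hS) fun f hf => ?_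
        by_contra hfS
        exact hS (hV0 f hf (le_of_eq (hall0 f hf).symm) S hfS)
      -- conclude by the point-mass lemma
      refine fm_point_mass 𝔽 e a F k ha0 hsupp hhom hswap he𝔽 fun S heS haS => hpt S ?_
      simpa [hbdef, heS] using haS

/-- **Feder–Mihail inequality on the whole type**: for a non-negative, homogeneous, stable-or-zero
family `a` on `Finset σ`, a coordinate `e` and a functional `F` with the swap property
`F(S) ≤ F(S ∖ e ∪ g)` (`a(S) ≠ 0`, `e ∈ S`, `g ∉ S`):
`(Σ_{S ∋ e} a F)(Σ a) ≤ (Σ a F)(Σ_{S ∋ e} a)`. -/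
theorem feder_mihail_univ (a : Finset σ → ℝ) (k : ℕ) (F : Finset σ → ℝ) (e : σ)
    (ha0 : ∀ S, 0 ≤ a S)
    (hst : (∀ S, a S = 0) ∨
      ∀ z : σ → ℂ, (∀ i, 0 < (z i).im) → (∑ S : Finset σ, (a S : ℂ) * ∏ i ∈ S, z i) ≠ 0)
    (hhom : ∀ S, a S ≠ 0 → S.card = k)
    (hswap : ∀ S, a S ≠ 0 → e ∈ S → ∀ g, g ∉ S → F S ≤ F (insert g (S.erase e))) :
    (∑ S ∈ univ.filter (fun S : Finset σ => e ∈ S), a S * F S) * (∑ S, a S) ≤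
      (∑ S, a S * F S) * (∑ S ∈ univ.filter (fun S : Finset σ => e ∈ S), a S) :=
  feder_mihail e _ univ rfl a k F ha0 (fun S _ => Finset.subset_univ S) hst hhom
    fun S hS heS g _ hgS => hswap S hS heS g hgS

end FederMihail

end Summit.CriticalPhenomena.PercolationContinuityZ3.Theorems
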